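import Summits.HodgeConjecture.HodgeConjecture.Theorems.F0P3cStCharTSK0WeylG            -- ★ p850013 «K0-WEYL-G★» (LH5-p05 (g2)): `weylElt_mem_of_iff_glInt_three`, `weylElt_mul_mul_inv_mem_level_three` (XIG′ clauses 5 ∕ 11 ⇒ `w₀ ∈ K₀`, `hKw`)
import Summits.HodgeConjecture.HodgeConjecture.Theorems.F0P3cStCharTSShellTracePS        -- ★ p849436 F1-G (LH10-p02): the `hiff` text + ED. 2 discharger `forall_cmTorusCharPair_eq_one_iff_of_weylConj_mem`
import Summits.HodgeConjecture.HodgeConjecture.Theorems.F0P3cStCharTSVanDijkWeylSymm     -- ★ p849696: `exists_weylElt` (some `w₀ ∈ U(Φ₃)(L⁺_v)` has matrix `Φ₃`)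
import HarnessLib

/-!
# F0 · P3c · line LH6 «StCharTS» — road (D), «HIFF-OF-K0 (G side)★»: F1-G's `hiff` for EVERY `(χ₁, χ₂)` at EVERY level of an Iwahori datum of `U(Φ₃)(L⁺_v)`
# whose levels are normalised by a compact-open `K₀ = E₃⁻¹ GL₃(𝒪_w)` (XIG′ clauses 5 + 11)  [Rogawski1990, §12.2 p. 173; §12.7 L. 12.7.3 (proof) p. 195]

Cell `pub/hodgecm-mathlib`, crux H413 = `stmt-HodgeConjecture-24833` (lane `--supports … --as helper`), route HCCMUnconditional; seat A-p16 (g34), road (D) (owner LH6-p04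
(g3): RULING (U2)(G) 2026-09-02T06:44:04Z «HIFF-OF-K0 (G side)», «=» 06:56:40Z).  This is the part of this seat's rf `F0P3cStCharTSK0WeylG` fd70d00a837b3bc7 NOT covered by
★ p850013 (LH5-p05 (g2), same target, landed first; repair proposed by LH5-p05 06:58:18Z: «lands unchanged as a NEW file … `exact`-ing mine»).  THEOREMS ONLY (no definition, no
instance, no notation, no named fact, no `sorry`); ★-only imports.  HONEST LABEL: HC_CM is proved only modulo the 7 printed citations (2 remaining: hLiu418 =
stmt-HodgeConjecture-24832, h413 = stmt-HodgeConjecture-24833) until rung 0 closes; count-neutral plumbing of road (D).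

WHAT IS HERE.  For `𝓘 : (cmBorelTriple L 3 v).IwahoriDatum` and `K₀ ≤ U(Φ₃)(L⁺_v)` with XIG′ clause 5 `hKK₀ : ∀ n, ∀ k ∈ K₀, ∀ κ ∈ 𝓘.K n, k⁻¹ κ k ∈ 𝓘.K n` and clause 11
`hK₀ : k ∈ K₀ ↔ E₃ k ∈ GL₃(𝒪_w)` (texts VERBATIM = conjuncts 6 ∕ 12 of ★ `exists_cmIwahoriDatum`), the hypothesis `hiff` of ★ F1-G
`smoothTrace_cmPrincipalSeries_indicator_shell_eq_ite` — «`χ|_{K_n ∩ T₃} = 1 ↔ (wχ)|_{K_n ∩ T₃} = 1`» — holds for EVERY pair `(χ₁, χ₂)` and EVERY level `n`: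
* `hiff_of_weylElt_of_iff_glInt` — for a given Weyl element `w₀` (matrix `Φ₃`): ★ p850013 `weylElt_mul_mul_inv_mem_level_three` (`hKw`) fed to the ★ F1-G ED. 2 discharger
  `forall_cmTorusCharPair_eq_one_iff_of_weylConj_mem` at `K := 𝓘.K n` (`χ(w₀ t w₀⁻¹) = (wχ)(t)` ★ `cmTorusCharPair_weylConj`);
* **`hiff_of_iff_glInt`** — `w₀`-free (★ `F0P3cStCharTSVanDijkWeylSymm.exists_weylElt`): the one name the XIG′ head ∕ ① OCAN-SHELL's caller passes as F1-G's `hiff`.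

## References
* [Rogawski1990] J. D. Rogawski, *Automorphic Representations of Unitary Groups in Three Variables*, Ann. of Math. Stud. 123 (1990): §1.10 p. 9; §12.2 p. 173
  (`w(χ₁, χ₂) = (χ̄₁⁻¹, χ₂)`); §12.7 Lemma 12.7.3 (proof) p. 195.
* [Casselman1995] W. Casselman, *Introduction to the theory of admissible representations of 𝔭-adic reductive groups* (1995 notes), §1.4, Lemma 7.1.1 (a) p. 67.
-/

set_option autoImplicit false
-- the mandated namespace has the single-problem summit's repeated segment (`HodgeConjecture.HodgeConjecture`)
set_option linter.dupNamespace false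

noncomputable section

open NumberField IsDedekindDomain
open scoped Matrix MatrixGroups Pointwise
open Literature.NumberTheory Literature.NumberTheory.Automorphic Literature.NumberTheory.Automorphic.UnitaryGroup
open Literature.NumberTheory.GaloisRepresentations
open Literature.NumberTheory.Rogawski1990

namespace Summit.HodgeConjecture.HodgeConjecture.Cruxes.H413.F0P3cStCharTSK0WeylGHiff

variable (L : Type) [Field L] [NumberField L] [IsCMField L] (v : HeightOneSpectrum (𝓞 ↥(maximalRealSubfield L)))
  (w : PlacesOver L v) (hw : IsCMField.complexConj L • w.1 = w.1)

/-- **F1-G's `hiff` AT A GIVEN WEYL ELEMENT, from XIG′ clauses 5 + 11**: for `w₀ ∈ U(Φ₃)(L⁺_v)` with matrix `Φ₃`, every pair `(χ₁, χ₂)` and every level `n`,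
`χ|_{K_n ∩ T₃} = 1 ↔ (wχ)|_{K_n ∩ T₃} = 1` (text of ★ `smoothTrace_cmPrincipalSeries_indicator_shell_eq_ite`'s `hiff` VERBATIM): `hKw` is ★ p850013
`weylElt_mul_mul_inv_mem_level_three`, then the ★ F1-G ED. 2 discharger at `K := 𝓘.K n`. [cite: Rogawski1990, §12.2 p. 173; §12.7 L. 12.7.3 (proof) p. 195]
[cite: Casselman1995, Lemma 7.1.1 (a) p. 67] -/
theorem hiff_of_weylElt_of_iff_glInt (𝓘 : (cmBorelTriple L 3 v).IwahoriDatum)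
    (K₀ : Subgroup ↥(unitaryGroupOfForm (conjLocal L (IsCMField.complexConj L) v) (cmLocalForm L 3 v)))
    (hKK₀ : ∀ n, ∀ k ∈ K₀, ∀ κ ∈ 𝓘.K n, k⁻¹ * κ * k ∈ 𝓘.K n)
    (hK₀ : ∀ k : ↥(unitaryGroupOfForm (conjLocal L (IsCMField.complexConj L) v) (cmLocalForm L 3 v)), k ∈ K₀ ↔
      ((((localNonsplitEquiv (IsCMField.complexConj L) (Rogawski1990.qsForm L) (IsCMField.complexConj_ne_one L) w hw) k :
        ↥(unitaryGroupOfForm (galAdicCompletionMap (L := L) (IsCMField.complexConj L) hw) (placeForm (Rogawski1990.qsForm L) w.1))) :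
          GL (Fin 3) (w.1.adicCompletion L)) ∈ glInt 3 (w.1.adicCompletion L)))
    (w₀ : ↥(unitaryGroupOfForm (conjLocal L (IsCMField.complexConj L) v) (cmLocalForm L 3 v)))
    (hw₀ : Units.val (w₀ : GL (Fin 3) (LocalRing L v)) = cmLocalForm L 3 v)
    (χ₁ : (LocalRing L v)ˣ →* ℂˣ) (χ₂ : ↥(normOneUnits (conjLocal L (IsCMField.complexConj L) v)) →* ℂˣ) (n : ℕ) :
    (∀ k : ↥(cmBorelTriple L 3 v).M, (k : ↥(unitaryGroupOfForm (conjLocal L (IsCMField.complexConj L) v) (cmLocalForm L 3 v))) ∈ 𝓘.K n →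
        cmTorusCharPair L v χ₁ χ₂ k = 1) ↔
      (∀ k : ↥(cmBorelTriple L 3 v).M, (k : ↥(unitaryGroupOfForm (conjLocal L (IsCMField.complexConj L) v) (cmLocalForm L 3 v))) ∈ 𝓘.K n →
        cmWeylTorusCharPair L v χ₁ χ₂ k = 1) :=
  F0P3cStCharTSShellTracePS.forall_cmTorusCharPair_eq_one_iff_of_weylConj_mem L v (𝓘.K n) w₀ hw₀
    (F0P3cStCharTSK0WeylG.weylElt_mul_mul_inv_mem_level_three L v w hw 𝓘 K₀ hKK₀ hK₀ w₀ hw₀ n) χ₁ χ₂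

/-- **«HIFF-OF-K0 (G side)★» — F1-G's `hiff` FROM XIG′ CLAUSES 5 + 11 ALONE** (`w₀`-free: a Weyl element exists, ★ `F0P3cStCharTSVanDijkWeylSymm.exists_weylElt`): for EVERY
`(χ₁, χ₂)` and EVERY level `n` of a datum whose levels are normalised by `K₀ = E₃⁻¹ GL₃(𝒪_w)` — e.g. the (T1) package ★ `exists_cmIwahoriDatum` — the hypothesis `hiff` of ★
`smoothTrace_cmPrincipalSeries_indicator_shell_eq_ite` holds (texts VERBATIM). [cite: Rogawski1990, §1.10 p. 9; §12.2 p. 173; §12.7 L. 12.7.3 (proof) p. 195]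
[cite: Casselman1995, Lemma 7.1.1 (a) p. 67] -/
theorem hiff_of_iff_glInt (𝓘 : (cmBorelTriple L 3 v).IwahoriDatum)
    (K₀ : Subgroup ↥(unitaryGroupOfForm (conjLocal L (IsCMField.complexConj L) v) (cmLocalForm L 3 v)))
    (hKK₀ : ∀ n, ∀ k ∈ K₀, ∀ κ ∈ 𝓘.K n, k⁻¹ * κ * k ∈ 𝓘.K n)
    (hK₀ : ∀ k : ↥(unitaryGroupOfForm (conjLocal L (IsCMField.complexConj L) v) (cmLocalForm L 3 v)), k ∈ K₀ ↔
      ((((localNonsplitEquiv (IsCMField.complexConj L) (Rogawski1990.qsForm L) (IsCMField.complexConj_ne_one L) w hw) k :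
        ↥(unitaryGroupOfForm (galAdicCompletionMap (L := L) (IsCMField.complexConj L) hw) (placeForm (Rogawski1990.qsForm L) w.1))) :
          GL (Fin 3) (w.1.adicCompletion L)) ∈ glInt 3 (w.1.adicCompletion L)))
    (χ₁ : (LocalRing L v)ˣ →* ℂˣ) (χ₂ : ↥(normOneUnits (conjLocal L (IsCMField.complexConj L) v)) →* ℂˣ) (n : ℕ) :
    (∀ k : ↥(cmBorelTriple L 3 v).M, (k : ↥(unitaryGroupOfForm (conjLocal L (IsCMField.complexConj L) v) (cmLocalForm L 3 v))) ∈ 𝓘.K n →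
        cmTorusCharPair L v χ₁ χ₂ k = 1) ↔
      (∀ k : ↥(cmBorelTriple L 3 v).M, (k : ↥(unitaryGroupOfForm (conjLocal L (IsCMField.complexConj L) v) (cmLocalForm L 3 v))) ∈ 𝓘.K n →
        cmWeylTorusCharPair L v χ₁ χ₂ k = 1) := by
  obtain ⟨w₀, hw₀⟩ := F0P3cStCharTSVanDijkWeylSymm.exists_weylElt L v
  exact hiff_of_weylElt_of_iff_glInt L v w hw 𝓘 K₀ hKK₀ hK₀ w₀ hw₀ χ₁ χ₂ n

end Summit.HodgeConjecture.HodgeConjecture.Cruxes.H413.F0P3cStCharTSK0WeylGHiff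

end
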